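import Summits.Ventures.HSemireg.WedgeHankelOuterFamily
import Summits.Ventures.HSemireg.WedgeKernelDuality

/-!
# Venture HSemireg — THE JOINT IMAGE LAW (SUM OF IMAGES): for every finite family of classes `w_N(q_c)` of one box and `k + k′ = N`, **the degree-`k′` images span the annihilator of
# the degree-`k` joint kernel, `⨆_c V(univ, w_N q_c, k′) = Ann_{k′+N}(Hom(univ,k) ⊓ ⋂_c Kr(univ, w_N q_c, k))`, and have dimension `C(N,k) · rank [H_k(q_c)]_c`** — the block Hankel
# matrix of the MIRROR degree (one class: THEOREM H by `rank H_k = rank H_{N−k}`; several classes: the matrices `H_{k′}(q_c)` stacked VERTICALLY, not side by side)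

HONEST FRAMING. Part of the Lean index of the computation cell `pub-hsemireg` (seat p10 gen 24, Sunday typer «UNIFORM-IN-n»).
Finite-dimensional EXTERIOR ALGEBRA over a field ONLY: no variety, no cohomology theory, no sheaf, no Ext group, no semiregularity map;
nothing here says that HC / HC_CM / HC_AV holds; no Literature fact is declared or used.  Custodian versions as in `WedgeHankelSiegelIdeal` (1/3) and `WedgeKernelDuality` (E1); the
dictionary (`V(univ, w_N q, k′)` = the image of `θ ↦ θ ∧ v` on `HT^{k′}`; a family = several classes of one box) is QUOTED, never asserted.

WHAT IS IN THE TREE.  E1 (`WedgeKernelDuality`): `Ann`, `mem_Ann`, `mem_Ann_iSup_iff`, `Ann_le_Hom`, `Ann_Ann` (double annihilator), `Ann_inf` (two subspaces), `finrank_Ann_add` (perfect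
pairing), **`V_w_eq_Ann`** (`V(univ, w_N q, k′) = Ann_{k′+N}(Kr(univ, w_N q, k))`, `k + k′ = N`); J1 (`WedgeHankelOuterFamily`): `finrank_iInf_Kr_w_top_add` (the joint kernel law); F6/G4
(`WedgeHankelCoSiegelDecomposition`, `…DivisorIntersection` §93): the co-Siegel space as the (direct) sum of NODE images for divisors — special families.
THIS FILE (namespace `Summit.Ventures.HSemireg.Wedge.HankelOuter` continued; imports J1 and E1):
* §420 `Ann_iSup_eq` (`Ann_b(⨆_c X_c) = Hom(univ,b) ⊓ ⋂_c Ann_b(X_c)`), **`Ann_Hom_inf_iInf`** (`Ann_a(Hom(univ,b) ⊓ ⋂_c W_c) = ⨆_c Ann_a(W_c)` for `W_c ≤ Hom(univ,b)`, `a + b = |I|`: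
  the annihilator of a finite intersection is the sum of the annihilators — E1's `Ann_inf` for families, by the double annihilator).
* §421 **THE JOINT IMAGE LAW `iSup_V_w_eq_Ann`: `⨆_c V(univ, w_N q_c, k′) = Ann_{k′+N}(Hom(univ,k) ⊓ ⋂_c Kr(univ, w_N q_c, k))`** (`k + k′ = N`) and
  **`finrank_iSup_V_w`: `dim (⨆_c V(univ, w_N q_c, k′)) = C(N,k) · rank (hank K N k q)`** (every finite family, every field); `finrank_iSup_V_w_add_finrank_Hom_iInf_Kr_w` (the two laws add
  up to `C(2N,k)`).
READING: the kernel side (J1) and the image side of a family are one perfect pairing apart; the images of several classes in degree `k′` are controlled by the catalecticants of the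
mirror degree `k = N − k′` SIDE BY SIDE — e.g. `k′ = N`: all top images lie in `K·vol`, dimension `rank` of the single row `(q_c(t))_{c,t}` `= 1` as soon as one class is non-zero.
Nothing Ext-side.  New names only.
-/

open Module

namespace Summit.Ventures.HSemireg.Wedge.HankelOuter

open Summit.Ventures.HSemireg.Wedge Summit.Ventures.HSemireg.Wedge.Kunneth Summit.Ventures.HSemireg.Wedge.Hankel
  Summit.Ventures.HSemireg.Wedge.BasisFree Summit.Ventures.HSemireg.Wedge.HankelSiegel Summit.Ventures.HSemireg.Wedge.HankelSiegelIdeal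
  Summit.Ventures.HSemireg.Wedge.KunnethKernel Summit.Ventures.HSemireg.Wedge.HankelFrameChange Summit.Ventures.HSemireg.Wedge.KernelDuality

variable (K : Type*) [Field K] {N : ℕ} {ι : Type} [Fintype ι] [DecidableEq ι]

/-! ## §420. The annihilator of a finite intersection is the sum of the annihilators -/

section AnnFamily

variable {I : Type*} [LinearOrder I] [Fintype I]

omit [Fintype ι] [DecidableEq ι] in
/-- `Ann_b(⨆_c X_c) = Hom(univ,b) ⊓ ⋂_c Ann_b(X_c)` (any index type). -/
theorem Ann_iSup_eq (b : ℕ) (X : ι → Submodule K (HT K I)) : Ann K b (⨆ c, X c) = Hom K I Finset.univ b ⊓ ⨅ c, Ann K b (X c) := by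
  ext θ
  rw [mem_Ann_iSup_iff, Submodule.mem_inf, Submodule.mem_iInf]
  refine and_congr_right fun hθ => forall_congr' fun c => ?_
  rw [mem_Ann]
  exact ⟨fun h => ⟨hθ, h⟩, fun h => h.2⟩

omit [Fintype ι] [DecidableEq ι] in
/-- **`Ann_a(Hom(univ,b) ⊓ ⋂_c W_c) = ⨆_c Ann_a(W_c)`** for subspaces `W_c ≤ Hom(univ,b)` and `a + b = |I|` (finite index type; the `Hom(univ,b) ⊓` makes the empty family right). -/
theorem Ann_Hom_inf_iInf {a b : ℕ} (hab : a + b = Fintype.card I) (W : ι → Submodule K (HT K I)) (hW : ∀ c, W c ≤ Hom K I Finset.univ b) :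
    Ann K a (Hom K I Finset.univ b ⊓ ⨅ c, W c) = ⨆ c, Ann K a (W c) := by
  have hX : (⨆ c, Ann K a (W c)) ≤ Hom K I Finset.univ a := iSup_le fun c => Ann_le_Hom K a (W c)
  have key : Ann K b (⨆ c, Ann K a (W c)) = Hom K I Finset.univ b ⊓ ⨅ c, W c := by
    rw [Ann_iSup_eq]
    congr 1
    exact iInf_congr fun c => Ann_Ann K hab (hW c)
  rw [← key, Ann_Ann K (a := b) (b := a) (by omega) hX]

end AnnFamily

/-! ## §421. The joint image law -/

omit [Fintype ι] [DecidableEq ι] in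
/-- **THE JOINT IMAGE LAW (annihilator form): `⨆_c V(univ, w_N q_c, k′) = Ann_{k′+N}(Hom(univ,k) ⊓ ⋂_c Kr(univ, w_N q_c, k))`** for `k + k′ = N` and every finite family — the
degree-`k′` images of the classes span exactly the annihilator of their degree-`k` joint kernel. -/
theorem iSup_V_w_eq_Ann {k k' : ℕ} (h : k + k' = N) (q : ι → ℕ → K) :
    (⨆ c, V K (In N) Finset.univ (w K N N (q c)) k')
      = Ann K (k' + N) (Hom K (In N) Finset.univ k ⊓ ⨅ c, Kr K Finset.univ (w K N N (q c)) k) := by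
  rw [Ann_Hom_inf_iInf K (a := k' + N) (b := k) (by rw [Fintype.card_fin]; omega) _ (fun c => Kr_le_Hom K _ _ _)]
  exact iSup_congr fun c => V_w_eq_Ann K h (q c)

/-- **THE JOINT IMAGE LAW: `dim (⨆_c V(univ, w_N q_c, k′)) = C(N,k) · rank (hank K N k q)`** for `k + k′ = N`, every finite family `q`, every field — the images of the classes in
degree `k′` span `C(N,k)` copies of the column space of the MIRROR-degree block matrix `[H_k(q_c)]_c` (one class: THEOREM H, as `rank H_k = rank H_{N−k}`). -/
theorem finrank_iSup_V_w {k k' : ℕ} (h : k + k' = N) (q : ι → ℕ → K) :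
    finrank K ↥(⨆ c, V K (In N) Finset.univ (w K N N (q c)) k') = N.choose k * (hank K N k (fun (_ : Unit) (c : ι) => q c)).rank := by
  have h1 := finrank_Ann_add K (I := In N) (a := k' + N) (b := k) (by rw [Fintype.card_fin]; omega)
    (W := Hom K (In N) Finset.univ k ⊓ ⨅ c, Kr K Finset.univ (w K N N (q c)) k) inf_le_left
  rw [← iSup_V_w_eq_Ann K h, Fintype.card_fin, show k' + N = N + N - k by omega, Nat.choose_symm (by omega)] at h1
  have h2 := finrank_iInf_Kr_w_top_add K (N := N) k q
  omega

/-- the two laws side by side: **`dim (⨆_c V(univ, w_N q_c, k′)) + dim (Hom(univ,k) ⊓ ⋂_c Kr(univ, w_N q_c, k)) = C(2N, k)`** (`k + k′ = N`). -/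
theorem finrank_iSup_V_w_add_finrank_Hom_iInf_Kr_w {k k' : ℕ} (h : k + k' = N) (q : ι → ℕ → K) :
    finrank K ↥(⨆ c, V K (In N) Finset.univ (w K N N (q c)) k')
      + finrank K ↥(Hom K (In N) Finset.univ k ⊓ ⨅ c, Kr K Finset.univ (w K N N (q c)) k) = (N + N).choose k := by
  rw [finrank_iSup_V_w K h]
  have h2 := finrank_iInf_Kr_w_top_add K (N := N) k q
  omega

end Summit.Ventures.HSemireg.Wedge.HankelOuter
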